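import Summits.Ventures.CertifiedArithmetic.Expansions.IncircleStageC
import Summits.Ventures.CertifiedArithmetic.Expansions.EstimateRelativeError
import Summits.Ventures.CertifiedArithmetic.Expansions.StageBMarginsAttained
import Literature.ComputerArithmetic.GraillatLefevreMuller2015.IntegerPowers
import Mathlib.Tactic.NormNum
import Mathlib.Tactic.Linarith
import Mathlib.Tactic.Positivity
import Mathlib.Tactic.Ring

/-!
# Stage C of INCIRCLE is sound — the unconditional statements

NEW WORK in the sense of this development (a corollary file; nothing here is a literature fact).
`IncircleStageC.lean` proves the soundness of the stage-C test of `incircleadapt` generically in the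
relative error bound `δ` of `estimate` on W-expansions of floats and in the coefficient `K_R`, and
instantiates the lane's `δ = 3ε`, `K_R = (3 + 24ε)ε` (`incircleStageC_correct_of_estimate`).
`EstimateRelativeError.lean` proves `δ = 3ε` (`abs_estimate_sub_sum_le_of_isWeakExpansion`) and the
sharp `δ = (5/2)ε` (`abs_estimate_sub_sum_le_sharp_of_isWeakExpansion`); `StageBMarginsAttained`
proves the margin of Shewchuk's PRINTED `K_R = (3 + 8ε)ε` for `δ = (5/2)ε`, `p ≥ 5`.  This file
discharges the hypotheses: the FMA / Dekker two-product instances given the estimate bound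
(`incircleStageC_fma_correct_of_estimate`, `incircleStageC_dekker_correct_of_estimate`), the
unconditional statements with the lane's `K_R = (3 + 24ε)ε` (`p ≥ 5`), and the unconditional
statements with the PRINTED `K_R = (3 + 8ε)ε` (`p ≥ 5`: `incircleStageC_correct_printed`,
`incircleStageC_fma_correct_printed`).

* `incircleStageC_correct` — `p ≥ 5`, `fl` a `RoundoffBelow 2` round-to-nearest into `F(p, emin)`,
  coordinates in `F(p, e₀)` with `emin ≤ e₀`, `emin + 3p ≤ 4e₀`, `tp` error-free on `F(p, e₀)²`,
  `F(p, 2e₀) × F(p, e₀)` and `F(p, 3e₀) × F(p, e₀)`: if stage C (coefficients `iccerrboundC p`,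
  `o3dresulterrbound24 p`, stage A's permanent) returns `d`, then `d > 0 ↔ (9) > 0` and
  `d < 0 ↔ (9) < 0` for the exact `incircleDet`.
* `incircleStageC_fma_correct`, `incircleStageC_dekker_correct` — the FMA two-product; Dekker's
  TWO-PRODUCT with `predicates.c`'s splitter (`p ≤ 2s ≤ p + 1`, rounding odd,
  `e₀ ≥ emin + p − 1`, `2e₀ ≥ emin + 2p − 1`).
* `incircleStageB_estimate_sign_of_tails_zero` — the early exit "all tails zero ⇒ return stage
  B's `det`" returns a value with the sign of `(9)`, zero included (`p ≥ 4`).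

HONEST CAVEATS, unchanged: exact model over `ℚ`, no overflow; for binary64 the format hypothesis
means coordinates that are multiples of `2^−228`; `K_C` is Shewchuk's constant certified for
`p ≥ 5` only; `K_R = (3 + 24ε)ε` is ours; `predicates.c`'s `(3 + 8ε)ε` is certified here for
`p ≥ 5` as well (`incircleStageC_correct_printed`); only the SIGN of the returned value is
claimed; stage D is not treated here.

References: J. R. Shewchuk, Discrete Comput. Geom. 18 (1997) 305–363, §4.4 and `predicates.c`
[Shewchuk1997].
-/

namespace Summit.Ventures.CertifiedArithmetic.Expansions

open Literature.ComputerArithmetic.JeannerodRump2018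
open Literature.ComputerArithmetic.BoldoJeannerodMelquiondMuller2023 hiding twoSum twoSum_fst
  isFloat_twoSum
open Literature.ComputerArithmetic.Shewchuk1997

variable {p : ℕ} {emin : ℤ} {fl : ℚ → ℚ}

/-! ## Instances given the `estimate` bound: FMA two-product; Dekker two-product -/

/-- **Stage C with the FMA two-product** (`2Prod_FMA`), given the `estimate` bound: sound for
`p ≥ 5`, any `RoundoffBelow 2` round-to-nearest, coordinates in `F(p, e₀)` with `emin ≤ e₀`,
`emin + 3p ≤ 4e₀`. -/
theorem incircleStageC_fma_correct_of_estimate (hp : 5 ≤ p) (hfl : IsRoundNearest p emin fl)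
    (hfl2 : RoundoffBelow 2 fl)
    (hest3 : ∀ ⦃l : List ℚ⦄, (∀ x ∈ l, IsFloat p emin x) → IsWeakExpansion l →
      |estimate fl l - l.sum| ≤ 3 * unitRoundoff p * |l.sum|)
    {e₀ : ℤ} (he₀ : emin ≤ e₀) (h4p : emin + 3 * p ≤ e₀ + e₀ + e₀ + e₀)
    {a₁ a₂ b₁ b₂ c₁ c₂ d₁ d₂ : ℚ}
    (ha₁ : IsFloat p e₀ a₁) (ha₂ : IsFloat p e₀ a₂) (hb₁ : IsFloat p e₀ b₁)
    (hb₂ : IsFloat p e₀ b₂) (hc₁ : IsFloat p e₀ c₁) (hc₂ : IsFloat p e₀ c₂)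
    (hd₁ : IsFloat p e₀ d₁) (hd₂ : IsFloat p e₀ d₂) {d : ℚ}
    (hC : incircleStageC (twoProdFMA fl) fl (iccerrboundC p) (o3dresulterrbound24 p)
      (incirclePermanent fl a₁ a₂ b₁ b₂ c₁ c₂ d₁ d₂) a₁ a₂ b₁ b₂ c₁ c₂ d₁ d₂ = some d) :
    (0 < d ↔ 0 < incircleDet a₁ a₂ b₁ b₂ c₁ c₂ d₁ d₂) ∧
      (d < 0 ↔ incircleDet a₁ a₂ b₁ b₂ c₁ c₂ d₁ d₂ < 0) := by
  have hp1 : 1 ≤ p := le_trans (by norm_num) hp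
  have he₂ : emin ≤ e₀ + e₀ := by omega
  have he₃ : emin ≤ e₀ + e₀ + e₀ := by omega
  have he₄ : emin ≤ e₀ + e₀ + e₀ + e₀ := by omega
  exact incircleStageC_correct_of_estimate hp hfl hfl2 hest3 he₀ h4p ha₁ ha₂ hb₁ hb₂ hc₁ hc₂ hd₁ hd₂
    (fun x y hx hy => exactTwoProd_twoProdFMA₂ hp1 hfl he₂ hx hy)
    (fun x y hx hy => exactTwoProd_twoProdFMA₂ hp1 hfl he₃ hx hy)
    (fun x y hx hy => exactTwoProd_twoProdFMA₂ hp1 hfl he₄ hx hy) hC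

/-- **Stage C with Shewchuk's TWO-PRODUCT** (Dekker, split point `s`, `p ≤ 2s ≤ p + 1`, rounding
odd and `RoundoffBelow 2` — ties-to-even qualifies), given the `estimate` bound: sound for `p ≥ 5`
and coordinates in `F(p, e₀)` with `e₀ ≥ emin + p − 1`, `2e₀ ≥ emin + 2p − 1` (Theorem 18's
no-underflow regime for the two-products) and `4e₀ ≥ emin + 3p` (stage C's grids; together they
give `3e₀, 4e₀ ≥ emin + 2p − 1`).  For binary64: coordinates that are multiples of `2^−228`. -/
theorem incircleStageC_dekker_correct_of_estimate (hp : 5 ≤ p) {s : ℕ} (hs2 : p ≤ 2 * s)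
    (hs2' : 2 * s ≤ p + 1) (hfl : IsRoundNearest p emin fl) (hodd : ∀ t, fl (-t) = -fl t)
    (hfl2 : RoundoffBelow 2 fl)
    (hest3 : ∀ ⦃l : List ℚ⦄, (∀ x ∈ l, IsFloat p emin x) → IsWeakExpansion l →
      |estimate fl l - l.sum| ≤ 3 * unitRoundoff p * |l.sum|)
    {e₀ : ℤ} (h1 : emin + p - 1 ≤ e₀) (h2 : emin + 2 * p - 1 ≤ e₀ + e₀)
    (h4p : emin + 3 * p ≤ e₀ + e₀ + e₀ + e₀) {a₁ a₂ b₁ b₂ c₁ c₂ d₁ d₂ : ℚ}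
    (ha₁ : IsFloat p e₀ a₁) (ha₂ : IsFloat p e₀ a₂) (hb₁ : IsFloat p e₀ b₁)
    (hb₂ : IsFloat p e₀ b₂) (hc₁ : IsFloat p e₀ c₁) (hc₂ : IsFloat p e₀ c₂)
    (hd₁ : IsFloat p e₀ d₁) (hd₂ : IsFloat p e₀ d₂) {d : ℚ}
    (hC : incircleStageC (twoProduct fl s) fl (iccerrboundC p) (o3dresulterrbound24 p)
      (incirclePermanent fl a₁ a₂ b₁ b₂ c₁ c₂ d₁ d₂) a₁ a₂ b₁ b₂ c₁ c₂ d₁ d₂ = some d) :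
    (0 < d ↔ 0 < incircleDet a₁ a₂ b₁ b₂ c₁ c₂ d₁ d₂) ∧
      (d < 0 ↔ incircleDet a₁ a₂ b₁ b₂ c₁ c₂ d₁ d₂ < 0) := by
  have hp4 : 4 ≤ p := le_trans (by norm_num) hp
  have he₀ : emin ≤ e₀ := by omega
  exact incircleStageC_correct_of_estimate hp hfl hfl2 hest3 he₀ h4p ha₁ ha₂ hb₁ hb₂ hc₁ hc₂ hd₁ hd₂
    (fun x y hx hy => exactTwoProd_twoProduct₂ hp4 hs2 hs2' hfl hodd h1 h1 h2 hx hy)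
    (fun x y hx hy => exactTwoProd_twoProduct₂ hp4 hs2 hs2' hfl hodd (by omega) h1 (by omega) hx hy)
    (fun x y hx hy => exactTwoProd_twoProduct₂ hp4 hs2 hs2' hfl hodd (by omega) h1 (by omega) hx hy)
    hC

/-! ## The unconditional statements (the lane's `K_R = (3 + 24ε)ε`) -/

/-- **THE STAGE-C TEST OF `incircleadapt` IS SOUND with `K_C = (44 + 576ε)ε²`, `K_R = (3 + 24ε)ε`**
(`p ≥ 5`, any `RoundoffBelow 2` round-to-nearest, coordinates in `F(p, e₀)` with `emin ≤ e₀`,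
`emin + 3p ≤ 4e₀`, two-product error-free on `F(p, e₀)²`, `F(p, 2e₀) × F(p, e₀)` and
`F(p, 3e₀) × F(p, e₀)`): if stage C returns `d`, then `d > 0 ↔ (9) > 0` and `d < 0 ↔ (9) < 0`. -/
theorem incircleStageC_correct (hp : 5 ≤ p) (hfl : IsRoundNearest p emin fl)
    (hfl2 : RoundoffBelow 2 fl) {e₀ : ℤ} (he₀ : emin ≤ e₀)
    (h4p : emin + 3 * p ≤ e₀ + e₀ + e₀ + e₀) {a₁ a₂ b₁ b₂ c₁ c₂ d₁ d₂ : ℚ}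
    (ha₁ : IsFloat p e₀ a₁) (ha₂ : IsFloat p e₀ a₂) (hb₁ : IsFloat p e₀ b₁)
    (hb₂ : IsFloat p e₀ b₂) (hc₁ : IsFloat p e₀ c₁) (hc₂ : IsFloat p e₀ c₂)
    (hd₁ : IsFloat p e₀ d₁) (hd₂ : IsFloat p e₀ d₂)
    {tp : ℚ → ℚ → ℚ × ℚ}
    (htp : ∀ x y, IsFloat p e₀ x → IsFloat p e₀ y → ExactTwoProd p emin fl tp x y)
    (htp' : ∀ x y, IsFloat p (e₀ + e₀) x → IsFloat p e₀ y → ExactTwoProd p emin fl tp x y)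
    (htp'' : ∀ x y, IsFloat p (e₀ + e₀ + e₀) x → IsFloat p e₀ y → ExactTwoProd p emin fl tp x y)
    {d : ℚ}
    (hC : incircleStageC tp fl (iccerrboundC p) (o3dresulterrbound24 p)
      (incirclePermanent fl a₁ a₂ b₁ b₂ c₁ c₂ d₁ d₂) a₁ a₂ b₁ b₂ c₁ c₂ d₁ d₂ = some d) :
    (0 < d ↔ 0 < incircleDet a₁ a₂ b₁ b₂ c₁ c₂ d₁ d₂) ∧
      (d < 0 ↔ incircleDet a₁ a₂ b₁ b₂ c₁ c₂ d₁ d₂ < 0) :=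
  incircleStageC_correct_of_estimate hp hfl hfl2
    (fun _ hF hW =>
      abs_estimate_sub_sum_le_of_isWeakExpansion (le_trans (by norm_num) hp) hfl hF hW)
    he₀ h4p ha₁ ha₂ hb₁ hb₂ hc₁ hc₂ hd₁ hd₂ htp htp' htp'' hC

/-- **Stage C with the FMA two-product** is sound (`p ≥ 5`, any `RoundoffBelow 2`
round-to-nearest, coordinates in `F(p, e₀)` with `emin ≤ e₀`, `emin + 3p ≤ 4e₀`). -/
theorem incircleStageC_fma_correct (hp : 5 ≤ p) (hfl : IsRoundNearest p emin fl)
    (hfl2 : RoundoffBelow 2 fl) {e₀ : ℤ} (he₀ : emin ≤ e₀)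
    (h4p : emin + 3 * p ≤ e₀ + e₀ + e₀ + e₀) {a₁ a₂ b₁ b₂ c₁ c₂ d₁ d₂ : ℚ}
    (ha₁ : IsFloat p e₀ a₁) (ha₂ : IsFloat p e₀ a₂) (hb₁ : IsFloat p e₀ b₁)
    (hb₂ : IsFloat p e₀ b₂) (hc₁ : IsFloat p e₀ c₁) (hc₂ : IsFloat p e₀ c₂)
    (hd₁ : IsFloat p e₀ d₁) (hd₂ : IsFloat p e₀ d₂) {d : ℚ}
    (hC : incircleStageC (twoProdFMA fl) fl (iccerrboundC p) (o3dresulterrbound24 p)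
      (incirclePermanent fl a₁ a₂ b₁ b₂ c₁ c₂ d₁ d₂) a₁ a₂ b₁ b₂ c₁ c₂ d₁ d₂ = some d) :
    (0 < d ↔ 0 < incircleDet a₁ a₂ b₁ b₂ c₁ c₂ d₁ d₂) ∧
      (d < 0 ↔ incircleDet a₁ a₂ b₁ b₂ c₁ c₂ d₁ d₂ < 0) :=
  incircleStageC_fma_correct_of_estimate hp hfl hfl2
    (fun _ hF hW =>
      abs_estimate_sub_sum_le_of_isWeakExpansion (le_trans (by norm_num) hp) hfl hF hW)
    he₀ h4p ha₁ ha₂ hb₁ hb₂ hc₁ hc₂ hd₁ hd₂ hC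

/-- **Stage C with Shewchuk's TWO-PRODUCT** (Dekker, split point `s`, `p ≤ 2s ≤ p + 1`, rounding
odd and `RoundoffBelow 2`) is sound for `p ≥ 5` and coordinates in `F(p, e₀)` with
`e₀ ≥ emin + p − 1`, `2e₀ ≥ emin + 2p − 1`, `4e₀ ≥ emin + 3p`. -/
theorem incircleStageC_dekker_correct (hp : 5 ≤ p) {s : ℕ} (hs2 : p ≤ 2 * s)
    (hs2' : 2 * s ≤ p + 1) (hfl : IsRoundNearest p emin fl) (hodd : ∀ t, fl (-t) = -fl t)
    (hfl2 : RoundoffBelow 2 fl) {e₀ : ℤ} (h1 : emin + p - 1 ≤ e₀)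
    (h2 : emin + 2 * p - 1 ≤ e₀ + e₀) (h4p : emin + 3 * p ≤ e₀ + e₀ + e₀ + e₀)
    {a₁ a₂ b₁ b₂ c₁ c₂ d₁ d₂ : ℚ}
    (ha₁ : IsFloat p e₀ a₁) (ha₂ : IsFloat p e₀ a₂) (hb₁ : IsFloat p e₀ b₁)
    (hb₂ : IsFloat p e₀ b₂) (hc₁ : IsFloat p e₀ c₁) (hc₂ : IsFloat p e₀ c₂)
    (hd₁ : IsFloat p e₀ d₁) (hd₂ : IsFloat p e₀ d₂) {d : ℚ}
    (hC : incircleStageC (twoProduct fl s) fl (iccerrboundC p) (o3dresulterrbound24 p)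
      (incirclePermanent fl a₁ a₂ b₁ b₂ c₁ c₂ d₁ d₂) a₁ a₂ b₁ b₂ c₁ c₂ d₁ d₂ = some d) :
    (0 < d ↔ 0 < incircleDet a₁ a₂ b₁ b₂ c₁ c₂ d₁ d₂) ∧
      (d < 0 ↔ incircleDet a₁ a₂ b₁ b₂ c₁ c₂ d₁ d₂ < 0) :=
  incircleStageC_dekker_correct_of_estimate hp hs2 hs2' hfl hodd hfl2
    (fun _ hF hW =>
      abs_estimate_sub_sum_le_of_isWeakExpansion (le_trans (by norm_num) hp) hfl hF hW)
    h1 h2 h4p ha₁ ha₂ hb₁ hb₂ hc₁ hc₂ hd₁ hd₂ hC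

/-- **The early exit is sound**: if all six TWO-DIFF-TAILs vanish, stage B's
`det = estimate(fin1)` has the sign of the exact determinant, zero included (`p ≥ 4`, any
`RoundoffBelow 2` round-to-nearest, `emin ≤ e₀, 2e₀, 3e₀, 4e₀`). -/
theorem incircleStageB_estimate_sign_of_tails_zero (hp : 4 ≤ p) (hfl : IsRoundNearest p emin fl)
    (hfl2 : RoundoffBelow 2 fl) {e₀ : ℤ} (he₀ : emin ≤ e₀) (he₂ : emin ≤ e₀ + e₀)
    (he₃ : emin ≤ e₀ + e₀ + e₀) (he₄ : emin ≤ e₀ + e₀ + e₀ + e₀)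
    {a₁ a₂ b₁ b₂ c₁ c₂ d₁ d₂ : ℚ}
    (ha₁ : IsFloat p e₀ a₁) (ha₂ : IsFloat p e₀ a₂) (hb₁ : IsFloat p e₀ b₁)
    (hb₂ : IsFloat p e₀ b₂) (hc₁ : IsFloat p e₀ c₁) (hc₂ : IsFloat p e₀ c₂)
    (hd₁ : IsFloat p e₀ d₁) (hd₂ : IsFloat p e₀ d₂)
    {tp : ℚ → ℚ → ℚ × ℚ}
    (htp : ∀ x y, IsFloat p e₀ x → IsFloat p e₀ y → ExactTwoProd p emin fl tp x y)
    (htp' : ∀ x y, IsFloat p (e₀ + e₀) x → IsFloat p e₀ y → ExactTwoProd p emin fl tp x y)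
    (htp'' : ∀ x y, IsFloat p (e₀ + e₀ + e₀) x → IsFloat p e₀ y → ExactTwoProd p emin fl tp x y)
    (hta₁ : fl (a₁ - d₁) = a₁ - d₁) (hta₂ : fl (a₂ - d₂) = a₂ - d₂) (htb₁ : fl (b₁ - d₁) = b₁ - d₁)
    (htb₂ : fl (b₂ - d₂) = b₂ - d₂) (htc₁ : fl (c₁ - d₁) = c₁ - d₁)
    (htc₂ : fl (c₂ - d₂) = c₂ - d₂) :
    let det := estimate fl (incircleB tp fl (fl (a₁ - d₁)) (fl (a₂ - d₂)) (fl (b₁ - d₁))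
      (fl (b₂ - d₂)) (fl (c₁ - d₁)) (fl (c₂ - d₂)))
    (0 < det ↔ 0 < incircleDet a₁ a₂ b₁ b₂ c₁ c₂ d₁ d₂) ∧
      (det < 0 ↔ incircleDet a₁ a₂ b₁ b₂ c₁ c₂ d₁ d₂ < 0) :=
  incircleStageB_estimate_sign_of_tails hp hfl hfl2
    (fun _ hF hW =>
      abs_estimate_sub_sum_le_of_isWeakExpansion (le_trans (by norm_num) hp) hfl hF hW)
    he₀ he₂ he₃ he₄ ha₁ ha₂ hb₁ hb₂ hc₁ hc₂ hd₁ hd₂ htp htp' htp'' hta₁ hta₂ htb₁ htb₂ htc₁ htc₂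

/-! ## Shewchuk's printed coefficients, `p ≥ 5` -/

/-- **SHEWCHUK'S PRINTED STAGE-C LINE IS CERTIFIED for `p ≥ 5`** (binary32, binary64, …): stage C
of `incircleadapt` run with the PRINTED coefficients `K_C = (44 + 576ε)ε²` and
`K_R = resulterrbound p = (3 + 8ε)ε` returns only values with the sign of the exact determinant
(same format / two-product hypotheses as `incircleStageC_correct`).  Ingredients: the sharp `(5/2)ε`
relative error bound of `estimate` on W-expansions
(`EstimateRelativeError.abs_estimate_sub_sum_le_sharp_of_isWeakExpansion`) and the margin
`StageBMarginsAttained.resulterrbound_margin_of_le_five_halves` (it holds from `p = 5`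
on, `GraillatLefevreMuller2015.unitRoundoff_le_of_five_le`, and fails at `p = 4`).  Within the
model only: exact arithmetic over `ℚ`, no overflow, inputs on the stated grid; the sign, not the
value. -/
theorem incircleStageC_correct_printed (hp : 5 ≤ p) (hfl : IsRoundNearest p emin fl)
    (hfl2 : RoundoffBelow 2 fl) {e₀ : ℤ} (he₀ : emin ≤ e₀)
    (h4p : emin + 3 * p ≤ e₀ + e₀ + e₀ + e₀) {a₁ a₂ b₁ b₂ c₁ c₂ d₁ d₂ : ℚ}
    (ha₁ : IsFloat p e₀ a₁) (ha₂ : IsFloat p e₀ a₂) (hb₁ : IsFloat p e₀ b₁)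
    (hb₂ : IsFloat p e₀ b₂) (hc₁ : IsFloat p e₀ c₁) (hc₂ : IsFloat p e₀ c₂)
    (hd₁ : IsFloat p e₀ d₁) (hd₂ : IsFloat p e₀ d₂)
    {tp : ℚ → ℚ → ℚ × ℚ}
    (htp : ∀ x y, IsFloat p e₀ x → IsFloat p e₀ y → ExactTwoProd p emin fl tp x y)
    (htp' : ∀ x y, IsFloat p (e₀ + e₀) x → IsFloat p e₀ y → ExactTwoProd p emin fl tp x y)
    (htp'' : ∀ x y, IsFloat p (e₀ + e₀ + e₀) x → IsFloat p e₀ y → ExactTwoProd p emin fl tp x y)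
    {d : ℚ}
    (hC : incircleStageC tp fl (iccerrboundC p) (resulterrbound p)
      (incirclePermanent fl a₁ a₂ b₁ b₂ c₁ c₂ d₁ d₂) a₁ a₂ b₁ b₂ c₁ c₂ d₁ d₂ = some d) :
    (0 < d ↔ 0 < incircleDet a₁ a₂ b₁ b₂ c₁ c₂ d₁ d₂) ∧
      (d < 0 ↔ incircleDet a₁ a₂ b₁ b₂ c₁ c₂ d₁ d₂ < 0) := by
  have hp2 : 2 ≤ p := le_trans (by norm_num) hp
  have hp5 : 5 ≤ p := le_trans (by norm_num) hp
  have hu0 : 0 < unitRoundoff p := by unfold unitRoundoff; positivity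
  have hu32 : unitRoundoff p ≤ 1 / 32 :=
    Literature.ComputerArithmetic.GraillatLefevreMuller2015.unitRoundoff_le_of_five_le hp5
  have hm := resulterrbound_margin_of_le_five_halves hu0
    (Literature.ComputerArithmetic.GraillatLefevreMuller2015.unitRoundoff_le_of_five_le hp)
    (le_of_eq (by ring) : 5 / 2 * unitRoundoff p ≤ 5 * unitRoundoff p / 2)
  exact incircleStageC_correct_of_estimate_of_margin hp5 hfl hfl2 (by positivity) (by linarith)
    (onGrid_resulterrbound p) (lt_of_lt_of_eq hm (by unfold resulterrbound; ring))
    (fun _ hF hW => abs_estimate_sub_sum_le_sharp_of_isWeakExpansion hp2 hfl hF hW) he₀ h4p ha₁ ha₂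
    hb₁ hb₂ hc₁ hc₂ hd₁ hd₂ htp htp' htp'' hC

/-- **The printed line with the FMA two-product**, `p ≥ 5` (e.g. binary64 with hardware FMA). -/
theorem incircleStageC_fma_correct_printed (hp : 5 ≤ p) (hfl : IsRoundNearest p emin fl)
    (hfl2 : RoundoffBelow 2 fl) {e₀ : ℤ} (he₀ : emin ≤ e₀)
    (h4p : emin + 3 * p ≤ e₀ + e₀ + e₀ + e₀) {a₁ a₂ b₁ b₂ c₁ c₂ d₁ d₂ : ℚ}
    (ha₁ : IsFloat p e₀ a₁) (ha₂ : IsFloat p e₀ a₂) (hb₁ : IsFloat p e₀ b₁)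
    (hb₂ : IsFloat p e₀ b₂) (hc₁ : IsFloat p e₀ c₁) (hc₂ : IsFloat p e₀ c₂)
    (hd₁ : IsFloat p e₀ d₁) (hd₂ : IsFloat p e₀ d₂) {d : ℚ}
    (hC : incircleStageC (twoProdFMA fl) fl (iccerrboundC p) (resulterrbound p)
      (incirclePermanent fl a₁ a₂ b₁ b₂ c₁ c₂ d₁ d₂) a₁ a₂ b₁ b₂ c₁ c₂ d₁ d₂ = some d) :
    (0 < d ↔ 0 < incircleDet a₁ a₂ b₁ b₂ c₁ c₂ d₁ d₂) ∧
      (d < 0 ↔ incircleDet a₁ a₂ b₁ b₂ c₁ c₂ d₁ d₂ < 0) := by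
  have hp1 : 1 ≤ p := le_trans (by norm_num) hp
  have he₂ : emin ≤ e₀ + e₀ := by omega
  have he₃ : emin ≤ e₀ + e₀ + e₀ := by omega
  have he₄ : emin ≤ e₀ + e₀ + e₀ + e₀ := by omega
  exact incircleStageC_correct_printed hp hfl hfl2 he₀ h4p ha₁ ha₂ hb₁ hb₂ hc₁ hc₂ hd₁ hd₂
    (fun x y hx hy => exactTwoProd_twoProdFMA₂ hp1 hfl he₂ hx hy)
    (fun x y hx hy => exactTwoProd_twoProdFMA₂ hp1 hfl he₃ hx hy)
    (fun x y hx hy => exactTwoProd_twoProdFMA₂ hp1 hfl he₄ hx hy) hC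

end Summit.Ventures.CertifiedArithmetic.Expansions
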